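import Literature.MathematicalPhysics.QuantumFieldTheory.Balaban1983to89.B12WardLeadingForm

/-!
# Bałaban CMP 109 (1987) §5, (5.43): the position-space kernel of the marginal term ½Σ(∂δB)(∂B)

CITATION HEADER (lean-in-tree rule 2026-08-18).  Source: T. Bałaban, *Renormalization group approach to lattice
gauge field theories. I.*, Commun. Math. Phys. **109**, 249–301 (1987), doi:10.1007/bf01215223 [Balaban1987RG1]
(held: `paper:balaban1987-cmp109-rg-i-small-field`; journal page = PDF page + 248).  Displays re-read on the
300-dpi renders of p. 291 [PDF 43] ((4.42)), p. 293 [45] ((5.11), (5.15), (5.16)) and p. 297 [49] ((5.36), (5.37),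
(5.43)) (`HOME/b2b-balaban-ref1/pages/1987-cmp109-rg-I-small-field/…-p043-x2.png`, `…-p045-x2.png`,
`…-p049-x2.png`).  The lattice curl is the cell's fixed convention (NOTATION.md §2.2, quoting Bałaban CMP 95
(1984) 17–40, p. 18 (1.2)): "F(p) = (∂A)(p) = ε^{−1}A(∂p) = (∂_μA_ν)(x) − (∂_νA_μ)(x)" with FORWARD differences
(∂_μf)(x) = f(x + e_μ) − f(x) on the unit lattice.
Audit cell `pub-balaban`, unit `b2b-balaban-b03-g6` (B12 §§2–5 lineage), node B12-PAIRING-543; sits on top of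
`…B12Rep537` (`dirac`, `fdelta`, `crossQ`, `wilsonQ`, `kron`, `hasSum_dirac_shift_mul`), `…B12WardLeadingForm`
(`dirac_neg`, `dirac_zero`, `dirac_eq_zero_of_apply`, the Ward identities of the transposed leading form).
Value = kernel certificate of a change of representation (position space, no Fourier transform), which turns the
"by hand" Parseval computation behind the located imprecision GAPS G-b03g6-4 (2) (cross-read C-pv03-28 (iii):
confirmed by hand and by exact integer evaluation for d = 2, 3) into a theorem for every d; NOT summit progress;
nothing about the sign or size of β.

THE PRINTED TEXT (verbatim).  NOTATION: the print writes Π_{μν}(p) without tilde for the momentum-space function of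
(5.11); inside quotation marks this header follows the print; outside them Π̃ (tilde ours) denotes that function.
* p. 291: (4.42) "β_j(g_{j−1})½Σ_{x,μ,ν} tr(∂δB)_{μν}(x)(∂B)_{μν}(x) + (irrelevant terms)."
* p. 293: (5.11) "Π_{μν}(p) = Σ_{x∈Z⁴} e^{−ip·x}Π_{μν}(x)"; (5.16) "Π_{μν}(p) = β(δ_{μν}Δ(p) − \overline{∂_μ(p)}∂_ν(p))
  + (terms of higher orders in derivatives ∂(p), \overline{∂(p)})".
* p. 297: (5.37) "Π_{μν}(p) = β(δ_{μν}Δ(p) − \overline{∂_μ(p)}∂_ν(p)) + Π′_{μν}(p)."; (5.43) "Σ_{(x,μ),(y,ν)}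
  Π_{μν}(x − y) tr δB_μ(x)B_ν(y) = β½Σ_{x,μ,ν} tr(∂δB)_{μν}(x)(∂B)_{μν}(x) + Σ_{(x,μ),(y,ν),κ,λ,ρ}[Π′_{μν,κλρ}(x − y)
  tr(∂_κ∂_λ∂_ρδB_μ)(x)B_ν(y) + Π′_{μν,κ,λρ}(x − y) tr(∂_λ∂_ρδB_μ)(x)(∂_κB_ν)(y) + …]."

WHAT IS TYPED AND PROVED (scalar components; `tr` is bilinear, so the matrix-valued statement is this one
componentwise).  For lattice vector fields `a b : Fin d → Pt d → ℂ` (a = δB, b = B):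
* `curl a μ ν x = (∂_μa_ν)(x) − (∂_νa_μ)(x)` (forward differences `B12Rep537.fdelta`), `fsq a b = ½ Σ'_x Σ_{μν}
  (∂a)_{μν}(x)(∂b)_{μν}(x)` — the first term of the right side of (5.43) without the factor β; `pairing K A B a b =
  Σ_{x∈A} Σ_{y∈B} Σ_{μν} K_{μν}(x − y) a_μ(x) b_ν(y)` — the left side of (5.43) for a kernel `K`, for fields vanishing
  off the finite sets `A`, `B`; `bvec μ₀ x₀` — the unit field on the bond (x₀, μ₀).
* MAIN (`fsq_bvec`, `fsq_eq_pairing_transpose`): `fsq (bvec μ₀ x₀) (bvec ν₀ y₀) = wilsonQ ν₀ μ₀ (x₀ − y₀)` and, by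
  bilinearity, `fsq a b = pairing (transposeK wilsonQ) A B a b` for all `a`, `b` vanishing off finite sets `A`, `B`
  (`transposeK wilsonQ μ ν = wilsonQ ν μ`): the position-space kernel that (5.43) pairs as
  `Π_{μν}(x − y)δB_μ(x)B_ν(y)` against its first right-hand term is β·`wilsonQ ν μ` — the TRANSPOSE of the kernel
  `wilsonQ μ ν` of the printed leading form of (5.16)/(5.36)/(5.37) = `B12WardLeadingForm`'s reading of (5.36)
  (whose symbol under (5.11) is δ_{μν}Δ(p) − \overline{∂_μ(p)}∂_ν(p), `B12Rep537.genFun_wilsonQ`); the symbol of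
  `wilsonQ ν μ` is δ_{μν}Δ(p) − ∂_μ(p)\overline{∂_ν(p)}.  This is the kernel form of claim (2) of GAPS G-b03g6-4
  (module `B12WardLeadingForm`: the transposed form is the exactly transverse one).
* WITNESS that the distinction is visible on two bonds (`fsq_bvec_adjacent`, `pairing_printed_adjacent`,
  `fsq_bvec_nonadjacent`, `pairing_printed_nonadjacent`; μ₀ ≠ ν₀, so d ≥ 2): the bonds (x₀, μ₀) and
  (x₀ − e_{ν₀}, ν₀) lie on a common plaquette and `fsq = 1`, while the printed kernel pairs them to `0`; the bonds
  (x₀, μ₀) and (x₀ − e_{μ₀}, ν₀) lie on no common plaquette and `fsq = 0`, while the printed kernel pairs them to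
  `1` (`fsq_ne_pairing_printed`).  As in G-b03g6-4 this is harmless for everything B12 does with (5.37) (the two
  kernels have the same Taylor data to second order, `B12WardLeadingForm.taylorData3_wilsonQ_transpose`), and it
  fixes the reading of (5.16)/(5.36)/(5.37): with ∂_μ(p)\overline{∂_ν(p)}.
* Sanity (`curl_grad`, `fsq_grad_left`, `fsq_grad_right`): `fsq` is invariant under a ↦ a + ∂λ and b ↦ b + ∂λ
  (curl ∘ grad = 0 because forward differences commute) — the structural reason why its kernel must satisfy BOTH
  Ward identities (5.15)/(5.21), which `wilsonQ ν μ` does and `wilsonQ μ ν` does not (`B12WardLeadingForm`).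
Nothing here is a cited fact; every statement is proved from the definitions.
-/

namespace Literature.MathematicalPhysics.QuantumFieldTheory.Balaban1983to89.B12Pairing543

noncomputable section

open Literature.MathematicalPhysics.QuantumFieldTheory.GawedzkiKupiainen1985.PeriodicGleason
open Literature.MathematicalPhysics.QuantumFieldTheory.Balaban1983to89.B12Rep537
open Literature.MathematicalPhysics.QuantumFieldTheory.Balaban1983to89.B12WardLeadingForm

variable {d : ℕ}

/-! ## The objects -/

/-- The lattice curl `(∂a)_{μν}(x) = (∂_μa_ν)(x) − (∂_νa_μ)(x)` with forward differences (cell NOTATION §2.2,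
Bałaban CMP 95 p. 18 (1.2)); `(∂δB)_{μν}`, `(∂B)_{μν}` of (4.42)/(5.43).
[cite: Balaban1987RG1, (4.42) p.291; (5.43) p.297] -/
def curl (a : Fin d → Pt d → ℂ) (μ ν : Fin d) (x : Pt d) : ℂ := fdelta μ (a ν) x - fdelta ν (a μ) x

/-- The lattice gradient `(∂λ)_μ = ∂_μλ` (forward difference). [folklore] -/
def grad (lam : Pt d → ℂ) : Fin d → Pt d → ℂ := fun μ => fdelta μ lam

/-- The unit field on the bond `(x₀, μ₀)`: `a_κ(x) = δ_{κμ₀}δ₀(x − x₀)`. [folklore] -/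
def bvec (μ₀ : Fin d) (x₀ : Pt d) : Fin d → Pt d → ℂ := fun κ x => kron κ μ₀ * dirac (x - x₀)

/-- The curl data of a bond field: `D^{x₀}_κ(x) = δ₀(x + e_κ − x₀) − δ₀(x − x₀)`. [folklore] -/
def bondD (x₀ : Pt d) (κ : Fin d) (x : Pt d) : ℂ := fdelta κ (fun z => dirac (z - x₀)) x

/-- **The first right-hand term of (5.43) without β**: `F(a, b) = ½ Σ_x Σ_{μ,ν} (∂a)_{μν}(x)(∂b)_{μν}(x)`
(a = δB, b = B; scalar components). [cite: Balaban1987RG1, (5.43) p.297; (4.42) p.291] -/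
def fsq (a b : Fin d → Pt d → ℂ) : ℂ := (1 / 2) * ∑' x, ∑ μ, ∑ ν, curl a μ ν x * curl b μ ν x

/-- **The left side of (5.43)** for a kernel `K`: `Σ_{(x,μ),(y,ν)} K_{μν}(x − y) a_μ(x) b_ν(y)`, written for fields
vanishing off the finite sets `A ∋ x`, `B ∋ y`. [cite: Balaban1987RG1, (5.43) p.297] -/
def pairing (K : Fin d → Fin d → Pt d → ℂ) (A B : Finset (Pt d)) (a b : Fin d → Pt d → ℂ) : ℂ :=
  ∑ x ∈ A, ∑ y ∈ B, ∑ μ, ∑ ν, K μ ν (x - y) * a μ x * b ν y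

/-- The transposed kernel `Kᵀ_{μν}(z) = K_{νμ}(z)`. [folklore] -/
def transposeK (K : Fin d → Fin d → Pt d → ℂ) : Fin d → Fin d → Pt d → ℂ := fun μ ν => K ν μ

/-! ## Gauge invariance of `F` -/

/-- Forward differences commute. [folklore] -/
theorem fdelta_comm (μ ν : Fin d) (g : Pt d → ℂ) : fdelta μ (fdelta ν g) = fdelta ν (fdelta μ g) := by
  funext x
  simp only [fdelta]
  rw [add_right_comm x (unitVec μ) (unitVec ν)]
  ring

/-- `curl ∘ grad = 0`. [folklore] -/
theorem curl_grad (lam : Pt d → ℂ) : curl (grad lam) = 0 := by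
  funext μ ν x
  show fdelta μ (fdelta ν lam) x - fdelta ν (fdelta μ lam) x = 0
  rw [fdelta_comm, sub_self]

/-- `F(∂λ, b) = 0`. [folklore] -/
theorem fsq_grad_left (lam : Pt d → ℂ) (b : Fin d → Pt d → ℂ) : fsq (grad lam) b = 0 := by
  simp [fsq, curl_grad]

/-- `F(a, ∂λ) = 0`. [folklore] -/
theorem fsq_grad_right (a : Fin d → Pt d → ℂ) (lam : Pt d → ℂ) : fsq a (grad lam) = 0 := by
  simp [fsq, curl_grad]

/-- The curl is antisymmetric. [folklore] -/
theorem curl_antisymm (a : Fin d → Pt d → ℂ) (μ ν : Fin d) (x : Pt d) : curl a ν μ x = -curl a μ ν x := by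
  simp only [curl]; ring

/-! ## Kronecker bookkeeping -/

/-- `Σ_i δ_{ij} f(i) = f(j)`. [folklore] -/
theorem sum_kron_mul (j : Fin d) (f : Fin d → ℂ) : ∑ i, kron i j * f i = f j := by
  simp only [kron, ite_mul, one_mul, zero_mul, Finset.sum_ite_eq', Finset.mem_univ, if_true]

/-- `Σ_i f(i) δ_{ji} = f(j)`. [folklore] -/
theorem sum_mul_kron (j : Fin d) (f : Fin d → ℂ) : ∑ i, f i * kron j i = f j := by
  simp only [kron, mul_ite, mul_one, mul_zero, Finset.sum_ite_eq, Finset.mem_univ, if_true]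

/-! ## Matrix elements on bond fields -/

/-- The curl of a bond field: `(∂ bvec^{x₀}_{μ₀})_{μν} = δ_{νμ₀}D^{x₀}_μ − δ_{μμ₀}D^{x₀}_ν`. [folklore] -/
theorem curl_bvec (μ₀ : Fin d) (x₀ : Pt d) (μ ν : Fin d) (x : Pt d) :
    curl (bvec μ₀ x₀) μ ν x = kron ν μ₀ * bondD x₀ μ x - kron μ μ₀ * bondD x₀ ν x := by
  simp only [curl, bvec, bondD, fdelta]
  ring

/-- Pointwise index algebra: `Σ_{μν} (∂bvec^{x₀}_{μ₀})_{μν}(∂bvec^{y₀}_{ν₀})_{μν}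
= 2(δ_{μ₀ν₀} Σ_κ D^{x₀}_κ D^{y₀}_κ − D^{x₀}_{ν₀} D^{y₀}_{μ₀})`. [folklore] -/
theorem sum_curl_bvec_mul (μ₀ ν₀ : Fin d) (x₀ y₀ x : Pt d) :
    ∑ μ, ∑ ν, curl (bvec μ₀ x₀) μ ν x * curl (bvec ν₀ y₀) μ ν x =
      2 * (kron μ₀ ν₀ * ∑ κ, bondD x₀ κ x * bondD y₀ κ x - bondD x₀ ν₀ x * bondD y₀ μ₀ x) := by
  have expand : ∀ μ ν, curl (bvec μ₀ x₀) μ ν x * curl (bvec ν₀ y₀) μ ν x =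
      kron ν μ₀ * (kron ν ν₀ * (bondD x₀ μ x * bondD y₀ μ x)) -
      kron ν μ₀ * (kron μ ν₀ * (bondD x₀ μ x * bondD y₀ ν x)) -
      kron μ μ₀ * (kron ν ν₀ * (bondD x₀ ν x * bondD y₀ μ x)) +
      kron μ μ₀ * (kron μ ν₀ * (bondD x₀ ν x * bondD y₀ ν x)) := by
    intro μ ν; rw [curl_bvec, curl_bvec]; ring
  simp_rw [expand, Finset.sum_add_distrib, Finset.sum_sub_distrib, ← Finset.mul_sum, sum_kron_mul,
    ← Finset.mul_sum]
  ring

/-- Pairing of a bond field's curl data with a test function: `Σ_x D^{x₀}_κ(x)φ(x) = (Δ*_κφ)(x₀)`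
(`PeriodicGleason.delta`: `(Δ*_κφ)(x₀) = φ(x₀ − e_κ) − φ(x₀)`). [folklore] -/
theorem hasSum_bondD_mul (x₀ : Pt d) (κ : Fin d) (φ : Pt d → ℂ) :
    HasSum (fun x => bondD x₀ κ x * φ x) (delta κ φ x₀) := by
  have h1 := hasSum_dirac_shift_mul (unitVec κ - x₀) φ
  have h2 := hasSum_dirac_shift_mul (-x₀) φ
  have e1 : -(unitVec κ - x₀) = x₀ - unitVec κ := by abel
  have e2 : -(-x₀) = x₀ := neg_neg x₀
  rw [e1] at h1
  rw [e2] at h2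
  have h := h1.sub h2
  refine h.congr_fun ?_
  intro x
  have e3 : x + unitVec κ - x₀ = x + (unitVec κ - x₀) := by abel
  have e4 : x - x₀ = x + -x₀ := by abel
  simp only [bondD, fdelta, e3, e4]
  ring

/-- `Σ_x D^{x₀}_κ(x) D^{y₀}_λ(x) = Δ*_κΔ_λδ₀(x₀ − y₀)` (translation invariance). [folklore] -/
theorem hasSum_bondD_mul_bondD (x₀ y₀ : Pt d) (κ lam : Fin d) :
    HasSum (fun x => bondD x₀ κ x * bondD y₀ lam x) (crossQ κ lam (x₀ - y₀)) := by
  have h := hasSum_bondD_mul x₀ κ (bondD y₀ lam)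
  have e : delta κ (bondD y₀ lam) x₀ = crossQ κ lam (x₀ - y₀) := by
    have e1 : x₀ - unitVec κ + unitVec lam - y₀ = x₀ - y₀ - unitVec κ + unitVec lam := by abel
    have e2 : x₀ - unitVec κ - y₀ = x₀ - y₀ - unitVec κ := by abel
    have e3 : x₀ + unitVec lam - y₀ = x₀ - y₀ + unitVec lam := by abel
    simp only [delta, bondD, fdelta, crossQ, e1, e2, e3]
  rw [e] at h
  exact h

/-- **The matrix-element form of (5.43)**: `Σ_x Σ_{μν} (∂bvec^{x₀}_{μ₀})_{μν}(x)(∂bvec^{y₀}_{ν₀})_{μν}(x)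
= 2·wilsonQ ν₀ μ₀ (x₀ − y₀)`. [cite: Balaban1987RG1, (5.43) p.297; (5.36)–(5.37) p.297] -/
theorem hasSum_curl_bvec (μ₀ ν₀ : Fin d) (x₀ y₀ : Pt d) :
    HasSum (fun x => ∑ μ, ∑ ν, curl (bvec μ₀ x₀) μ ν x * curl (bvec ν₀ y₀) μ ν x)
      (2 * wilsonQ ν₀ μ₀ (x₀ - y₀)) := by
  have hsum : HasSum (fun x => ∑ κ, bondD x₀ κ x * bondD y₀ κ x) (∑ κ, crossQ κ κ (x₀ - y₀)) :=
    hasSum_sum fun κ _ => hasSum_bondD_mul_bondD x₀ y₀ κ κ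
  have h := ((hsum.mul_left (kron μ₀ ν₀)).sub (hasSum_bondD_mul_bondD x₀ y₀ ν₀ μ₀)).mul_left 2
  have e : 2 * (kron μ₀ ν₀ * ∑ κ, crossQ κ κ (x₀ - y₀) - crossQ ν₀ μ₀ (x₀ - y₀)) =
      2 * wilsonQ ν₀ μ₀ (x₀ - y₀) := by
    by_cases hμν : μ₀ = ν₀
    · subst hμν; simp [wilsonQ, kron]
    · have : ν₀ ≠ μ₀ := fun h' => hμν h'.symm
      simp [wilsonQ, kron, hμν, this]
  rw [e] at h
  refine h.congr_fun ?_
  intro x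
  simp only [sum_curl_bvec_mul]

/-- The summand of `fsq` on bond fields is summable. [folklore] -/
theorem summable_curl_bvec (μ₀ ν₀ : Fin d) (x₀ y₀ : Pt d) :
    Summable (fun x => ∑ μ, ∑ ν, curl (bvec μ₀ x₀) μ ν x * curl (bvec ν₀ y₀) μ ν x) :=
  (hasSum_curl_bvec μ₀ ν₀ x₀ y₀).summable

/-- **(5.43), matrix elements**: `F(bvec^{x₀}_{μ₀}, bvec^{y₀}_{ν₀}) = wilsonQ ν₀ μ₀ (x₀ − y₀)` — the kernel paired
as `Π_{μν}(x − y)a_μ(x)b_ν(y)` against the marginal term is the TRANSPOSED leading form.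
[cite: Balaban1987RG1, (5.43) p.297; (5.16) p.293; (5.36)–(5.37) p.297] -/
theorem fsq_bvec (μ₀ ν₀ : Fin d) (x₀ y₀ : Pt d) :
    fsq (bvec μ₀ x₀) (bvec ν₀ y₀) = wilsonQ ν₀ μ₀ (x₀ - y₀) := by
  rw [fsq, (hasSum_curl_bvec μ₀ ν₀ x₀ y₀).tsum_eq]
  ring

/-! ## Bilinear extension to finitely supported fields -/

/-- Commuting the index sum past a double coefficient sum. [folklore] -/
theorem sum4_comm {ι κ : Type*} (s : Finset ι) (t : Finset κ) (f : Fin d → Fin d → ι → κ → ℂ) :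
    ∑ μ, ∑ ν, ∑ p ∈ s, ∑ q ∈ t, f μ ν p q = ∑ p ∈ s, ∑ q ∈ t, ∑ μ, ∑ ν, f μ ν p q :=
  calc ∑ μ, ∑ ν, ∑ p ∈ s, ∑ q ∈ t, f μ ν p q
      = ∑ μ, ∑ p ∈ s, ∑ ν, ∑ q ∈ t, f μ ν p q := Finset.sum_congr rfl fun _ _ => Finset.sum_comm
    _ = ∑ p ∈ s, ∑ μ, ∑ ν, ∑ q ∈ t, f μ ν p q := Finset.sum_comm
    _ = ∑ p ∈ s, ∑ μ, ∑ q ∈ t, ∑ ν, f μ ν p q :=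
        Finset.sum_congr rfl fun _ _ => Finset.sum_congr rfl fun _ _ => Finset.sum_comm
    _ = ∑ p ∈ s, ∑ q ∈ t, ∑ μ, ∑ ν, f μ ν p q := Finset.sum_congr rfl fun _ _ => Finset.sum_comm

/-- A field vanishing off `A` is the corresponding combination of bond fields. [folklore] -/
theorem eq_sum_bvec {A : Finset (Pt d)} {a : Fin d → Pt d → ℂ} (ha : ∀ μ x, x ∉ A → a μ x = 0)
    (κ : Fin d) (x : Pt d) :
    a κ x = ∑ p ∈ A ×ˢ (Finset.univ : Finset (Fin d)), a p.2 p.1 * bvec p.2 p.1 κ x := by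
  rw [Finset.sum_product]
  have inner : ∀ x₀ ∈ A, ∑ μ₀ : Fin d, a μ₀ x₀ * bvec μ₀ x₀ κ x = a κ x₀ * dirac (x - x₀) := by
    intro x₀ _
    have : ∀ μ₀, a μ₀ x₀ * bvec μ₀ x₀ κ x = a μ₀ x₀ * kron κ μ₀ * dirac (x - x₀) := by
      intro μ₀; simp only [bvec]; ring
    simp_rw [this, ← Finset.sum_mul, sum_mul_kron]
  rw [Finset.sum_congr rfl inner]
  by_cases hx : x ∈ A
  · rw [Finset.sum_eq_single_of_mem x hx]
    · simp [dirac]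
    · intro y _ hyx
      have : x - y ≠ 0 := sub_ne_zero.mpr (fun h => hyx h.symm)
      simp [dirac, this]
  · rw [ha κ x hx]
    refine (Finset.sum_eq_zero ?_).symm
    intro y hy
    have hxy : x ≠ y := fun h => hx (h ▸ hy)
    simp [dirac, sub_ne_zero.mpr hxy]

/-- The curl is linear: curl of a finite combination of fields. [folklore] -/
theorem curl_sum_mul {ι : Type*} (s : Finset ι) (c : ι → ℂ) (v : ι → Fin d → Pt d → ℂ)
    (μ ν : Fin d) (x : Pt d) :
    curl (fun κ z => ∑ i ∈ s, c i * v i κ z) μ ν x = ∑ i ∈ s, c i * curl (v i) μ ν x := by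
  simp only [curl, fdelta, ← Finset.sum_sub_distrib]
  refine Finset.sum_congr rfl ?_
  intro i _
  ring

/-- **(5.43), first term, as a kernel identity**: for fields `a`, `b` vanishing off finite sets `A`, `B`,
`½ Σ_x Σ_{μν} (∂a)_{μν}(x)(∂b)_{μν}(x) = Σ_{x∈A} Σ_{y∈B} Σ_{μν} wilsonQ ν μ (x − y) a_μ(x) b_ν(y)`: the
position-space kernel of the marginal term of (5.43) is the TRANSPOSE `z ↦ wilsonQ ν μ z` of the printed leading
form's kernel (symbol δ_{μν}Δ(p) − ∂_μ(p)\overline{∂_ν(p)} under (5.11), vs. the printed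
δ_{μν}Δ(p) − \overline{∂_μ(p)}∂_ν(p)). [cite: Balaban1987RG1, (5.43) p.297; (5.16) p.293; (5.36)–(5.37) p.297] -/
theorem fsq_eq_pairing_transpose {A B : Finset (Pt d)} {a b : Fin d → Pt d → ℂ}
    (ha : ∀ μ x, x ∉ A → a μ x = 0) (hb : ∀ ν y, y ∉ B → b ν y = 0) :
    fsq a b = pairing (transposeK wilsonQ) A B a b := by
  obtain ⟨PA, hPA⟩ : ∃ PA : Finset (Pt d × Fin d), PA = A ×ˢ Finset.univ := ⟨_, rfl⟩
  obtain ⟨PB, hPB⟩ : ∃ PB : Finset (Pt d × Fin d), PB = B ×ˢ Finset.univ := ⟨_, rfl⟩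
  obtain ⟨c, hc⟩ : ∃ c : Pt d × Fin d → ℂ, ∀ p, c p = a p.2 p.1 := ⟨_, fun _ => rfl⟩
  obtain ⟨e, he⟩ : ∃ e : Pt d × Fin d → ℂ, ∀ q, e q = b q.2 q.1 := ⟨_, fun _ => rfl⟩
  have ea : a = fun κ z => ∑ p ∈ PA, c p * bvec p.2 p.1 κ z := by
    funext κ z; simp only [hc, hPA]; exact eq_sum_bvec ha κ z
  have eb : b = fun κ z => ∑ q ∈ PB, e q * bvec q.2 q.1 κ z := by
    funext κ z; simp only [he, hPB]; exact eq_sum_bvec hb κ z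
  have ca : ∀ μ ν x, curl a μ ν x = ∑ p ∈ PA, c p * curl (bvec p.2 p.1) μ ν x := by
    intro μ ν x; rw [ea]; exact curl_sum_mul PA c (fun p => bvec p.2 p.1) μ ν x
  have cb : ∀ μ ν x, curl b μ ν x = ∑ q ∈ PB, e q * curl (bvec q.2 q.1) μ ν x := by
    intro μ ν x; rw [eb]; exact curl_sum_mul PB e (fun q => bvec q.2 q.1) μ ν x
  -- pointwise expansion of the integrand
  have point : ∀ x, ∑ μ, ∑ ν, curl a μ ν x * curl b μ ν x =
      ∑ p ∈ PA, ∑ q ∈ PB, c p * e q *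
        ∑ μ, ∑ ν, curl (bvec p.2 p.1) μ ν x * curl (bvec q.2 q.1) μ ν x := by
    intro x
    have hce : ∀ μ ν, curl a μ ν x * curl b μ ν x =
        ∑ p ∈ PA, ∑ q ∈ PB, c p * e q * (curl (bvec p.2 p.1) μ ν x * curl (bvec q.2 q.1) μ ν x) := by
      intro μ ν
      rw [ca, cb, Finset.sum_mul_sum]
      refine Finset.sum_congr rfl fun p _ => Finset.sum_congr rfl fun q _ => ?_
      ring
    simp_rw [hce]
    rw [sum4_comm]
    refine Finset.sum_congr rfl fun p _ => Finset.sum_congr rfl fun q _ => ?_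
    rw [Finset.mul_sum]
    refine Finset.sum_congr rfl fun μ _ => ?_
    rw [Finset.mul_sum]
  have hs : HasSum (fun x => ∑ μ, ∑ ν, curl a μ ν x * curl b μ ν x)
      (∑ p ∈ PA, ∑ q ∈ PB, c p * e q * (2 * wilsonQ q.2 p.2 (p.1 - q.1))) := by
    have h : HasSum (fun x => ∑ p ∈ PA, ∑ q ∈ PB, c p * e q *
        ∑ μ, ∑ ν, curl (bvec p.2 p.1) μ ν x * curl (bvec q.2 q.1) μ ν x)
        (∑ p ∈ PA, ∑ q ∈ PB, c p * e q * (2 * wilsonQ q.2 p.2 (p.1 - q.1))) :=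
      hasSum_sum fun p _ => hasSum_sum fun q _ => (hasSum_curl_bvec p.2 q.2 p.1 q.1).mul_left _
    exact h.congr_fun fun x => point x
  rw [fsq, hs.tsum_eq, pairing, hPA, Finset.mul_sum, Finset.sum_product]
  refine Finset.sum_congr rfl fun x _ => ?_
  simp only [Finset.mul_sum, hPB, Finset.sum_product, hc, he, transposeK]
  rw [Finset.sum_comm]
  refine Finset.sum_congr rfl fun y _ => Finset.sum_congr rfl fun μ _ => ?_
  refine Finset.sum_congr rfl fun ν _ => ?_
  ring

/-! ## The two-bond witness: the printed kernel is not the kernel of (5.43)'s first term -/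

/-- `Δ*_νΔ_μδ₀(e_ν) = −1` for `μ ≠ ν`. [folklore] -/
theorem crossQ_unitVec_fst {μ ν : Fin d} (h : μ ≠ ν) : crossQ ν μ (unitVec ν : Pt d) = -1 := by
  rw [crossQ_apply]
  have zμ : ∀ v : Pt d, v μ ≠ 0 → dirac v = 0 := fun v hv => dirac_eq_zero_of_apply μ hv
  have zν : ∀ v : Pt d, v ν ≠ 0 → dirac v = 0 := fun v hv => dirac_eq_zero_of_apply ν hv
  have e0 : (unitVec ν : Pt d) + -unitVec ν = 0 := by abel
  rw [zμ (unitVec ν + (unitVec μ - unitVec ν)) (by simp [unitVec, h]),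
    e0, dirac_zero, zμ (unitVec ν + unitVec μ) (by simp [unitVec, h]),
    add_zero, zν (unitVec ν) (by simp [unitVec])]
  norm_num

/-- `Δ*_μΔ_νδ₀(e_ν) = 0` for `μ ≠ ν`. [folklore] -/
theorem crossQ_unitVec_snd {μ ν : Fin d} (h : μ ≠ ν) : crossQ μ ν (unitVec ν : Pt d) = 0 := by
  rw [crossQ_apply]
  have zμ : ∀ v : Pt d, v μ ≠ 0 → dirac v = 0 := fun v hv => dirac_eq_zero_of_apply μ hv
  have zν : ∀ v : Pt d, v ν ≠ 0 → dirac v = 0 := fun v hv => dirac_eq_zero_of_apply ν hv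
  rw [zμ (unitVec ν + (unitVec ν - unitVec μ)) (by simp [unitVec, h]),
    zμ (unitVec ν + -unitVec μ) (by simp [unitVec, h]),
    zν (unitVec ν + unitVec ν) (by simp [unitVec]),
    add_zero, zν (unitVec ν) (by simp [unitVec])]
  norm_num

/-- The transposed kernel at `e_{ν₀}`: `wilsonQ ν₀ μ₀ (e_{ν₀}) = 1` (μ₀ ≠ ν₀). [folklore] -/
theorem wilsonQ_transpose_unitVec {μ₀ ν₀ : Fin d} (h : μ₀ ≠ ν₀) :
    wilsonQ ν₀ μ₀ (unitVec ν₀ : Pt d) = 1 := by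
  have h' : ν₀ ≠ μ₀ := fun e => h e.symm
  simp only [wilsonQ, if_neg h', crossQ_unitVec_fst h, zero_sub, neg_neg]

/-- The printed kernel at `e_{ν₀}`: `wilsonQ μ₀ ν₀ (e_{ν₀}) = 0` (μ₀ ≠ ν₀). [folklore] -/
theorem wilsonQ_printed_unitVec {μ₀ ν₀ : Fin d} (h : μ₀ ≠ ν₀) :
    wilsonQ μ₀ ν₀ (unitVec ν₀ : Pt d) = 0 := by
  simp only [wilsonQ, if_neg h, crossQ_unitVec_snd h, sub_self]

/-- Pairing of two bond fields through a kernel `K`: the matrix element `K_{μ₀ν₀}(x₀ − y₀)`. [folklore] -/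
theorem pairing_bvec (K : Fin d → Fin d → Pt d → ℂ) (μ₀ ν₀ : Fin d) (x₀ y₀ : Pt d) :
    pairing K {x₀} {y₀} (bvec μ₀ x₀) (bvec ν₀ y₀) = K μ₀ ν₀ (x₀ - y₀) := by
  unfold pairing
  rw [Finset.sum_singleton, Finset.sum_singleton]
  have h1 : ∀ μ ν, K μ ν (x₀ - y₀) * bvec μ₀ x₀ μ x₀ * bvec ν₀ y₀ ν y₀ =
      kron μ μ₀ * (kron ν ν₀ * K μ ν (x₀ - y₀)) := by
    intro μ ν; simp only [bvec, sub_self, dirac_zero]; ring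
  simp_rw [h1, ← Finset.mul_sum, sum_kron_mul]

/-- ADJACENT BONDS.  The bonds `(x₀, μ₀)` and `(x₀ − e_{ν₀}, ν₀)` (μ₀ ≠ ν₀) bound a common plaquette (the one
based at `x₀ − e_{ν₀}` in the μ₀ν₀-plane): `F = 1`. [cite: Balaban1987RG1, (5.43) p.297] -/
theorem fsq_bvec_adjacent {μ₀ ν₀ : Fin d} (h : μ₀ ≠ ν₀) (x₀ : Pt d) :
    fsq (bvec μ₀ x₀) (bvec ν₀ (x₀ - unitVec ν₀)) = 1 := by
  rw [fsq_bvec, sub_sub_cancel, wilsonQ_transpose_unitVec h]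

/-- … while the PRINTED kernel `wilsonQ μ ν` pairs these two adjacent bonds to `0`.
[cite: Balaban1987RG1, (5.16) p.293; (5.36)–(5.37) p.297] -/
theorem pairing_printed_adjacent {μ₀ ν₀ : Fin d} (h : μ₀ ≠ ν₀) (x₀ : Pt d) :
    pairing wilsonQ {x₀} {x₀ - unitVec ν₀} (bvec μ₀ x₀) (bvec ν₀ (x₀ - unitVec ν₀)) = 0 := by
  rw [pairing_bvec, sub_sub_cancel, wilsonQ_printed_unitVec h]

/-- NON-ADJACENT BONDS.  The bonds `(x₀, μ₀)` and `(x₀ − e_{μ₀}, ν₀)` (μ₀ ≠ ν₀) bound no common plaquette: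
`F = 0`. [cite: Balaban1987RG1, (5.43) p.297] -/
theorem fsq_bvec_nonadjacent {μ₀ ν₀ : Fin d} (h : μ₀ ≠ ν₀) (x₀ : Pt d) :
    fsq (bvec μ₀ x₀) (bvec ν₀ (x₀ - unitVec μ₀)) = 0 := by
  have h' : ν₀ ≠ μ₀ := fun e => h e.symm
  rw [fsq_bvec, sub_sub_cancel, wilsonQ_printed_unitVec h']

/-- … while the PRINTED kernel pairs these two non-adjacent bonds to `1`.
[cite: Balaban1987RG1, (5.16) p.293; (5.36)–(5.37) p.297] -/
theorem pairing_printed_nonadjacent {μ₀ ν₀ : Fin d} (h : μ₀ ≠ ν₀) (x₀ : Pt d) :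
    pairing wilsonQ {x₀} {x₀ - unitVec μ₀} (bvec μ₀ x₀) (bvec ν₀ (x₀ - unitVec μ₀)) = 1 := by
  have h' : ν₀ ≠ μ₀ := fun e => h e.symm
  rw [pairing_bvec, sub_sub_cancel, wilsonQ_transpose_unitVec h']

/-- **Conclusion (kernel form of GAPS G-b03g6-4 (2))**: pairing with the PRINTED leading kernel `wilsonQ μ ν` is
NOT the marginal term `½Σ(∂a)(∂b)` of (5.43) (two bonds suffice, any `d ≥ 2`), whereas pairing with its
transpose is (`fsq_eq_pairing_transpose`, `fsq_eq_pairing_transpose_bvec`).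
[cite: Balaban1987RG1, (5.43) p.297; (5.37) p.297] -/
theorem fsq_ne_pairing_printed {μ₀ ν₀ : Fin d} (h : μ₀ ≠ ν₀) (x₀ : Pt d) :
    fsq (bvec μ₀ x₀) (bvec ν₀ (x₀ - unitVec ν₀)) ≠
      pairing wilsonQ {x₀} {x₀ - unitVec ν₀} (bvec μ₀ x₀) (bvec ν₀ (x₀ - unitVec ν₀)) := by
  rw [fsq_bvec_adjacent h, pairing_printed_adjacent h]
  exact one_ne_zero

/-- For comparison, the transposed kernel gets every pair of bonds right (the singleton-support instance of
`fsq_eq_pairing_transpose`, here read off `fsq_bvec` directly). [cite: Balaban1987RG1, (5.43) p.297] -/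
theorem fsq_eq_pairing_transpose_bvec (μ₀ ν₀ : Fin d) (x₀ y₀ : Pt d) :
    fsq (bvec μ₀ x₀) (bvec ν₀ y₀) = pairing (transposeK wilsonQ) {x₀} {y₀} (bvec μ₀ x₀) (bvec ν₀ y₀) := by
  rw [fsq_bvec, pairing_bvec, transposeK]

end

end Literature.MathematicalPhysics.QuantumFieldTheory.Balaban1983to89.B12Pairing543
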